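import Mathlib
import Summits.ResolutionOfSingularities.ResolutionOfSingularities.Theorems.RadicialJungCleanModelsCleanProp44TauOneVeryNear
import Summits.ResolutionOfSingularities.ResolutionOfSingularities.Theorems.RadicialJungCleanModelsCleanProp44TauTwoRegimeOffCentre
import Summits.ResolutionOfSingularities.ResolutionOfSingularities.Theorems.RadicialJungCleanModelsCleanPermissibleTransport
import Summits.ResolutionOfSingularities.ResolutionOfSingularities.Theorems.RadicialJungCleanModelsCleanSeqOpenTransport
import HarnessLib

/-!
# Route `RadicialJung`, crux `CleanModels` (stmt-ResolutionOfSingularities-15917), line `Sketch` rev 35, stub 6 `stub_cleanProp44` (X44c):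
# the clean curve slice (R3) HOLDS for clean-permissible curves without very near points; X44c ⟸ (R1) ∧ (R2ᵛⁿ) ∧ (R3ᵛⁿ)

Seat decomp-res-hand-2 g15 (structural hand), companion of ✓ `…CleanProp44TauOneVeryNear.lean` (`cleanProp44_of_tauOneResidualVN`:
X44c ⟸ (R1) ∧ (R2ᵛⁿ) ∧ (R3)).  Here the CURVE slice (R3) `hcurveTauOne` of the census ✓ `cleanProp44_of_tauOneResidual` is narrowed the
same way:

* `exists_isCleanPermissibleSeq_lt_comap_of_curve_of_cleanPermissible_of_forall_near_two_le` — **(R3) HOLDS for a curve `Y` that is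
  CLEAN-PERMISSIBLE at each of its points (no L7b insertion needed) and has NO VERY NEAR POINT**: for every blowing up of the open `V`
  along `Y ∩ V`, every closed threefold near point over `Y` has `τ ≥ 2` (over the `τ ≥ 2` points of `Y` there is none, [CoP1] Lemma 4.3 (2);
  over a `τ = 1` point the near points form the fibre of `Γ′`, Lemma 4.3 (4)).  Proof: transport the standing hypotheses to the open
  subscheme `V` (as in ✓ `exists_isCleanPermissibleSeq_lt_comap_of_isolated_of_forall_near_two_le`; clean-permissibility ascends by
  ✓ `CleanPermissibleAt.functionFieldMap_of_isIso_stalkMap`), where the `m`-stratum is `Y ∩ V`, and apply ✓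
  `exists_isCleanPermissibleSeq_lt_of_two_le_stalkTau_off_centre`.
* `cleanProp44_of_tauOneResidualVN2` — **X44c ⟸ (R1) ∧ (R2ᵛⁿ) ∧ (R3ᵛⁿ)**: (R3ᵛⁿ) = (R3) restricted BY NAME to curves that are NOT
  (clean-permissible everywhere AND without very near points) — one more binder in `hcurveTauOne`; cases inside (R3).

NET for the planner: both curve-blowing hypotheses of the census now ask only for the configurations where an L7b INSERTION at a bad point
of the curve or a VERY NEAR point (a `Γ′`-point with `τ = 1`) occurs — the births world of memo 4e §2.4–2.6 and nothing else.

Honest framing: OURS; (R1), (R2ᵛⁿ), (R3ᵛⁿ) are NOT proved here; nothing here proves X44c, any case of `CleanModels`, or resolution of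
singularities in characteristic `p`. [cite: CossartPiltant2008, Prop. 4.2 (b), Lemma 4.3 (2) (4), Lemma 4.5, Prop. 4.4 (proof, pp. 10–11)]
[cite: Piltant2013, §2 Axiom 4, Prop. 5.1 (proof, Step 2)]
-/

noncomputable section

set_option linter.dupNamespace false -- mandated namespace of this single-conjunct summit

open CategoryTheory CategoryTheory.Limits AlgebraicGeometry TopologicalSpace IsLocalRing
open Literature.AlgebraicGeometry.Resolution Literature.AlgebraicGeometry.Motives
open Scheme.IdealSheafData
open Summit.ResolutionOfSingularities.ResolutionOfSingularities.Theorems.CP2008Prop44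

namespace Summit.ResolutionOfSingularities.ResolutionOfSingularities.Theorems.RadicialJung.CleanModels

/-! ## §1 (R3) for a clean-permissible curve without very near points -/

set_option maxHeartbeats 800000 in
-- transport of the standing hypotheses to the open subscheme
/-- **The clean curve slice HOLDS for a clean-permissible curve WITHOUT VERY NEAR POINTS.**  `X` integral Noetherian regular quasi-excellent of
dimension `≤ 3`, `char K(X) = p`, the line of `G` clean-regular at every point; `(J, m)` with `m ≥ 1`, `ord ≤ m`, `V(J)` of codimension `≥ 2`;
`V ⊆ X` open and `Y ⊆ V` closed in `X`, irreducible with regular reduced structure, `Y ⊆ {ord J = m}`, every point of order `≥ m` on `Y` or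
outside `V`; the line of `G` CLEAN-PERMISSIBLE for `𝓘_Y` at every point of `Y`; and NO VERY NEAR POINT over `Y`: for every blowing up
`π₁ : V₁ → V` of the open subscheme `V` along `Y ∩ V`, every closed point `x'` over `Y` with `ord_{x'} = m` and embedding dimension `3` has
`τ_{x'} ≥ 2`.  Then some CLEAN-permissible sequence for `(J|_V, m)` and the line of `G|_V` brings the order below `m` (the conclusion of (R3)
`hcurveTauOne` on `V`). [cite: CossartPiltant2008, Lemma 4.3 (2) (4), Prop. 4.4 (proof, pp. 10–11)] [cite: Piltant2013, §2 Axiom 4] -/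
theorem exists_isCleanPermissibleSeq_lt_comap_of_curve_of_cleanPermissible_of_forall_near_two_le {p : ℕ} (hp : p.Prime)
    {X : Scheme.{0}} [IsIntegral X] [IsNoetherian X] [hcharX : CharP X.functionField p] (hX : Scheme.IsRegular X)
    (hqe : Scheme.IsQuasiExcellent X) (hX3 : topologicalKrullDim X ≤ 3) (G : X.functionField)
    (hG : ∀ x : X, CleanRegAt p (algebraMap (X.presheaf.stalk x) X.functionField) G)
    (J : X.IdealSheafData) {m : ℕ} (hm : 1 ≤ m) (hle : ∀ z, idealOrder J z ≤ m) (hcodim : ∀ z ∈ J.support, 1 < Order.coheight z)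
    (V : X.Opens) (Y : Closeds X) (hYreg : Scheme.IsRegular (vanishingIdeal Y).subscheme) (hirr : IsIrreducible (Y : Set X))
    (hYV : (Y : Set X) ⊆ (V : Set X)) (hJY : ∀ z : X, (m : ℕ∞) ≤ idealOrder J z → z ∈ (Y : Set X) ∨ z ∉ (V : Set X))
    (hordY : ∀ y ∈ (Y : Set X), idealOrder J y = m)
    (hperm : ∀ y ∈ (Y : Set X), CleanPermissibleAt p (algebraMap (X.presheaf.stalk y) X.functionField) G (stalkIdeal (vanishingIdeal Y) y))
    (hvn : ∀ (V₁ : Scheme.{0}) (π₁ : V₁ ⟶ (V : Scheme.{0})), IsBlowup π₁ (vanishingIdeal (Y.preimage V.ι.continuous)) →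
      ∀ x' : V₁, IsClosed ({x'} : Set V₁) → π₁ x' ∈ ((Y.preimage V.ι.continuous : Closeds (V : Scheme.{0})) : Set (V : Scheme.{0})) →
        idealOrder (controlledTransform π₁ (vanishingIdeal (Y.preimage V.ι.continuous)) (J.comap V.ι) m) x' = m →
        (maximalIdeal (V₁.presheaf.stalk x')).spanFinrank = 3 →
        ∀ hr : IsRegularLocalRing (V₁.presheaf.stalk x'),
          2 ≤ @stalkTau V₁ (controlledTransform π₁ (vanishingIdeal (Y.preimage V.ι.continuous)) (J.comap V.ι) m) x' hr m)
    [IsIntegral ((V : X.Opens) : Scheme.{0})] [IsDominant V.ι] :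
    ∃ (V' : Scheme.{0}) (π : V' ⟶ V) (_ : IsIntegral V') (_ : IsDominant π) (K' : V'.IdealSheafData),
      IsCleanPermissibleSeq p π (J.comap V.ι) m K' (RatFn.functionFieldMap V.ι G) ∧ ∀ y, idealOrder K' y < m := by
  -- the open subscheme `V` inherits the standing hypotheses
  haveI : CompactSpace (V : Scheme.{0}) :=
    ⟨(V.ι.isOpenEmbedding.isInducing.isCompact_iff).mpr (NoetherianSpace.isCompact _)⟩
  haveI : IsNoetherian (V : Scheme.{0}) := {}
  have hV : Scheme.IsRegular (V : Scheme.{0}) := Scheme.IsRegular.of_isOpenImmersion V.ι hX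
  have hqeV : Scheme.IsQuasiExcellent (V : Scheme.{0}) := Scheme.IsQuasiExcellent.of_locallyOfFiniteType V.ι hqe
  have hcohV : ∀ v : (V : Scheme.{0}), Order.coheight v = Order.coheight (V.ι v) := fun v =>
    CampaignW46.coheight_eq_of_isIso_stalkMap V.ι v
  have hcoh3 : ∀ z : X, Order.coheight z ≤ 3 := (topologicalKrullDim_le_iff_forall_coheight_le X 3).mp hX3
  have hV3 : topologicalKrullDim (V : Scheme.{0}) ≤ 3 :=
    (topologicalKrullDim_le_iff_forall_coheight_le _ 3).mpr fun v => (hcohV v).symm ▸ hcoh3 _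
  haveI hcharV : CharP (V : Scheme.{0}).functionField p := charP_of_injective_ringHom (RatFn.functionFieldMap V.ι).injective p
  have hGV : ∀ v : (V : Scheme.{0}), CleanRegAt p (algebraMap ((V : Scheme.{0}).presheaf.stalk v) (V : Scheme.{0}).functionField)
      (RatFn.functionFieldMap V.ι G) := fun v =>
    CleanRegAt.functionFieldMap_of_isIso_stalkMap V.ι v (hG (V.ι v))
  have hordV : ∀ v : (V : Scheme.{0}), idealOrder (J.comap V.ι) v = idealOrder J (V.ι v) := fun v =>
    idealOrder_comap_of_isOpenImmersion V.ι J v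
  have hleV : ∀ v : (V : Scheme.{0}), idealOrder (J.comap V.ι) v ≤ m := fun v => by rw [hordV]; exact hle _
  have hcodimV : ∀ v ∈ (J.comap V.ι).support, 1 < Order.coheight v := by
    intro v hv
    rw [← one_le_idealOrder_iff, hordV, one_le_idealOrder_iff] at hv
    rw [hcohV]
    exact hcodim _ hv
  have hmemV : ∀ v : (V : Scheme.{0}), V.ι v ∈ (V : Set X) := fun v => by
    rw [← Scheme.Opens.range_ι V]; exact ⟨v, rfl⟩
  -- the curve seen in `V`
  set YV : Closeds (V : Scheme.{0}) := Y.preimage V.ι.continuous with hYVdef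
  have hmemYV : ∀ v : (V : Scheme.{0}), v ∈ (YV : Set (V : Scheme.{0})) ↔ V.ι v ∈ (Y : Set X) := fun v => by
    rw [hYVdef, Closeds.coe_preimage]; rfl
  have hCW : (vanishingIdeal Y).comap V.ι = vanishingIdeal YV := comap_vanishingIdeal_of_isOpenImmersion V.ι Y
  have hirrV : IsIrreducible (YV : Set (V : Scheme.{0})) := by
    refine ⟨?_, ?_⟩
    · obtain ⟨y, hy⟩ := hirr.nonempty
      refine ⟨⟨y, hYV hy⟩, (hmemYV _).mpr ?_⟩
      simpa [Scheme.Opens.ι_apply] using hy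
    · rw [hYVdef, Closeds.coe_preimage]
      exact hirr.isPreirreducible.preimage V.ι.isOpenEmbedding
  have hYVint : IsIntegral (vanishingIdeal YV).subscheme := ComponentGluing.isIntegral_subscheme_vanishingIdeal YV hirrV
  have hYVreg : Scheme.IsRegular (vanishingIdeal YV).subscheme := by
    rw [← hCW]
    exact isRegular_subscheme_comap_of_isOpenImmersion V.ι (vanishingIdeal Y) hYreg
  have hYVord : ∀ v ∈ (YV : Set (V : Scheme.{0})), idealOrder (J.comap V.ι) v = m := fun v hv => by
    rw [hordV]; exact hordY _ ((hmemYV v).mp hv)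
  -- clean-permissibility of the centre ascends to `V`
  have hpermV : ∀ v ∈ (YV : Set (V : Scheme.{0})), CleanPermissibleAt p (algebraMap ((V : Scheme.{0}).presheaf.stalk v) (V : Scheme.{0}).functionField)
      (RatFn.functionFieldMap V.ι G) (stalkIdeal (vanishingIdeal YV) v) := by
    intro v hv
    have h1 := CleanPermissibleAt.functionFieldMap_of_isIso_stalkMap (p := p) V.ι v (vanishingIdeal Y) (hperm (V.ι v) ((hmemYV v).mp hv))
    rw [hCW] at h1
    exact h1
  -- in `V` the `m`-stratum is `Y ∩ V`: `τ ≥ 2` off it holds vacuously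
  have hτ2V : ∀ v : (V : Scheme.{0}), v ∉ (YV : Set (V : Scheme.{0})) → IsClosed ({v} : Set (V : Scheme.{0})) →
      idealOrder (J.comap V.ι) v = m → (maximalIdeal ((V : Scheme.{0}).presheaf.stalk v)).spanFinrank = 3 →
      ∀ hr : IsRegularLocalRing ((V : Scheme.{0}).presheaf.stalk v), 2 ≤ @stalkTau (V : Scheme.{0}) (J.comap V.ι) v hr m := by
    intro v hv _ hordv _ _
    exfalso
    rcases hJY (V.ι v) (by rw [← hordV, hordv]) with h | h
    · exact hv ((hmemYV v).mpr h)
    · exact h (hmemV v)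
  -- the stage-free «one clean-permissible centre» theorem on `V`
  exact exists_isCleanPermissibleSeq_lt_of_two_le_stalkTau_off_centre hp hV hqeV hV3 (RatFn.functionFieldMap V.ι G) hGV (J.comap V.ι) hm
    hleV hcodimV YV hYVint hYVreg hYVord hpermV hvn hτ2V

/-! ## §2 X44c ⟸ (R1) ∧ (R2ᵛⁿ) ∧ (R3ᵛⁿ) -/

set_option maxHeartbeats 1600000 in
-- long binder lists
/-- **THE CLEAN ASSEMBLY, FIFTH CUT: X44c (`stub_cleanProp44`, verbatim) from (R1) clean Phase II of reach-tidy, (R2ᵛⁿ) the clean `τ = 1`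
isolated-point slice at points WITH a very near point, and (R3ᵛⁿ) the clean curve slice through a `τ = 1` point for curves that NEED an insertion or
HAVE a very near point.**  (R3ᵛⁿ) = the hypothesis `hcurveTauOne` of ✓ `cleanProp44_of_tauOneResidual` with ONE MORE binder: NOT (the line is
clean-permissible for `𝓘_Y` at every point of `Y` AND no very near point over `Y`).  Proof: cases inside (R3), over ✓ `cleanProp44_of_tauOneResidualVN`.
[cite: CossartPiltant2008, Prop. 4.4, Lemma 4.5] [cite: Piltant2013, Prop. 5.1 (proof, Step 2)] -/
theorem cleanProp44_of_tauOneResidualVN2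
    (hphaseTwo : ∀ (p : ℕ), p.Prime → ∀ {X : Scheme.{0}} [IsIntegral X] [IsNoetherian X], CharP X.functionField p →
      ∀ (hX : Scheme.IsRegular X), Scheme.IsQuasiExcellent X → topologicalKrullDim X ≤ 3 →
      ∀ (G : X.functionField), (∀ x : X, CleanRegAt p (algebraMap (X.presheaf.stalk x) X.functionField) G) →
      ∀ (J : X.IdealSheafData) {μ : ℕ}, 1 ≤ μ → (∀ z, idealOrder J z ≤ μ) → (∀ z ∈ J.support, 1 < Order.coheight z) →
      (∀ x : X, ¬ ∃ C ∈ {C : Closeds X | ∃ ζ ∈ maxPoints {z : X | (μ : ℕ∞) ≤ idealOrder J z},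
          ¬ IsClosed ({ζ} : Set X) ∧ C = ⟨closure {ζ}, isClosed_closure⟩},
        x ∈ (vanishingIdeal C).subschemeι '' (Scheme.regularLocus (vanishingIdeal C).subscheme)ᶜ ∨
        (x ∈ (C : Set X) ∧ ∃ C' ∈ {C : Closeds X | ∃ ζ ∈ maxPoints {z : X | (μ : ℕ∞) ≤ idealOrder J z},
            ¬ IsClosed ({ζ} : Set X) ∧ C = ⟨closure {ζ}, isClosed_closure⟩}, C' ≠ C ∧ x ∈ (C' : Set X) ∧
          stalkIdeal (vanishingIdeal C) x ⊔ stalkIdeal (vanishingIdeal C') x ≠ maximalIdeal (X.presheaf.stalk x))) →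
      ∃ (X₁ : Scheme.{0}) (Φ : X₁ ⟶ X) (_ : IsIntegral X₁) (_ : IsDominant Φ) (J₁ : X₁.IdealSheafData)
        (_ : IsCleanPermissibleSeq p Φ J μ J₁ G),
        (∀ ζ : X₁, (μ : ℕ∞) ≤ idealOrder J₁ ζ → Order.coheight ζ = 2 → ¬ IsClosed ({ζ} : Set X₁) →
            Scheme.IsRegular (vanishingIdeal (⟨closure {ζ}, isClosed_closure⟩ : Closeds X₁)).subscheme) ∧
        (∀ ζ₁ ζ₂ : X₁, (μ : ℕ∞) ≤ idealOrder J₁ ζ₁ → Order.coheight ζ₁ = 2 → ¬ IsClosed ({ζ₁} : Set X₁) →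
            (μ : ℕ∞) ≤ idealOrder J₁ ζ₂ → Order.coheight ζ₂ = 2 → ¬ IsClosed ({ζ₂} : Set X₁) → ζ₁ ≠ ζ₂ →
            Disjoint (closure ({ζ₁} : Set X₁)) (closure {ζ₂})))
    (htauOneVN : ∀ (p : ℕ), p.Prime → ∀ {X : Scheme.{0}} [IsIntegral X] [IsNoetherian X], CharP X.functionField p →
      ∀ (hX : Scheme.IsRegular X), Scheme.IsQuasiExcellent X → topologicalKrullDim X ≤ 3 →
      ∀ (G : X.functionField), (∀ x : X, CleanRegAt p (algebraMap (X.presheaf.stalk x) X.functionField) G) →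
      ∀ (J : X.IdealSheafData) {m : ℕ}, 1 ≤ m → (∀ z, idealOrder J z ≤ m) → (∀ z ∈ J.support, 1 < Order.coheight z) →
      ∀ (V : X.Opens) (x : X) (hxV : x ∈ V), ∀ (hcl : IsClosed ({x} : Set X)),
      (∀ z : X, (m : ℕ∞) ≤ idealOrder J z → z = x ∨ z ∉ (V : Set X)) → idealOrder J x = m →
      (maximalIdeal (X.presheaf.stalk x)).spanFinrank = 3 → (haveI := hX x; stalkTau J x m = 1) → IsGRing (X.presheaf.stalk x) →
      (¬ ∀ (hclV : IsClosed ({(⟨x, hxV⟩ : (V : Scheme.{0}))} : Set (V : Scheme.{0})))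
        (V₁ : Scheme.{0}) (π₁ : V₁ ⟶ (V : Scheme.{0})), IsBlowup π₁ (vanishingIdeal ⟨{(⟨x, hxV⟩ : (V : Scheme.{0}))}, hclV⟩) →
        ∀ x' : V₁, IsClosed ({x'} : Set V₁) → π₁ x' = ⟨x, hxV⟩ →
          idealOrder (controlledTransform π₁ (vanishingIdeal ⟨{(⟨x, hxV⟩ : (V : Scheme.{0}))}, hclV⟩) (J.comap V.ι) m) x' = m →
          (maximalIdeal (V₁.presheaf.stalk x')).spanFinrank = 3 →
          ∀ hr : IsRegularLocalRing (V₁.presheaf.stalk x'),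
            2 ≤ @stalkTau V₁ (controlledTransform π₁ (vanishingIdeal ⟨{(⟨x, hxV⟩ : (V : Scheme.{0}))}, hclV⟩) (J.comap V.ι) m) x' hr m) →
      ∀ [IsIntegral ((V : X.Opens) : Scheme.{0})] [IsDominant V.ι],
      ∃ (V' : Scheme.{0}) (π : V' ⟶ V) (_ : IsIntegral V') (_ : IsDominant π) (K' : V'.IdealSheafData),
        IsCleanPermissibleSeq p π (J.comap V.ι) m K' (RatFn.functionFieldMap V.ι G) ∧ ∀ y, idealOrder K' y < m)
    (hcurveTauOneVN : ∀ (p : ℕ), p.Prime → ∀ {X : Scheme.{0}} [IsIntegral X] [IsNoetherian X], CharP X.functionField p →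
      ∀ (hX : Scheme.IsRegular X), Scheme.IsQuasiExcellent X → topologicalKrullDim X ≤ 3 →
      ∀ (G : X.functionField), (∀ x : X, CleanRegAt p (algebraMap (X.presheaf.stalk x) X.functionField) G) →
      ∀ (J : X.IdealSheafData) {m : ℕ}, 1 ≤ m → (∀ z, idealOrder J z ≤ m) → (∀ z ∈ J.support, 1 < Order.coheight z) →
      ∀ (V : X.Opens) (Y : Closeds X), Scheme.IsRegular (vanishingIdeal Y).subscheme → IsIrreducible (Y : Set X) →
      (Y : Set X) ⊆ (V : Set X) → (∀ z : X, (m : ℕ∞) ≤ idealOrder J z → z ∈ (Y : Set X) ∨ z ∉ (V : Set X)) →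
      (∀ y ∈ (Y : Set X), idealOrder J y = m) →
      (∀ y ∈ (Y : Set X), haveI := hX y; ∃ c : Fin 2 → X.presheaf.stalk y, IsRsopPart c ∧
        Ideal.span (Set.range c) = stalkIdeal (vanishingIdeal Y) y) →
      (¬ ∀ y ∈ (Y : Set X), IsClosed ({y} : Set X) → haveI := hX y; 2 ≤ stalkTau J y m) →
      -- (VN) NOT (clean-permissible at every point of `Y` AND no very near point over `Y`)
      (¬ ((∀ y ∈ (Y : Set X), CleanPermissibleAt p (algebraMap (X.presheaf.stalk y) X.functionField) G (stalkIdeal (vanishingIdeal Y) y)) ∧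
          (∀ (V₁ : Scheme.{0}) (π₁ : V₁ ⟶ (V : Scheme.{0})), IsBlowup π₁ (vanishingIdeal (Y.preimage V.ι.continuous)) →
            ∀ x' : V₁, IsClosed ({x'} : Set V₁) →
              π₁ x' ∈ ((Y.preimage V.ι.continuous : Closeds (V : Scheme.{0})) : Set (V : Scheme.{0})) →
              idealOrder (controlledTransform π₁ (vanishingIdeal (Y.preimage V.ι.continuous)) (J.comap V.ι) m) x' = m →
              (maximalIdeal (V₁.presheaf.stalk x')).spanFinrank = 3 →
              ∀ hr : IsRegularLocalRing (V₁.presheaf.stalk x'),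
                2 ≤ @stalkTau V₁ (controlledTransform π₁ (vanishingIdeal (Y.preimage V.ι.continuous)) (J.comap V.ι) m) x' hr m))) →
      ∀ [IsIntegral ((V : X.Opens) : Scheme.{0})] [IsDominant V.ι],
      ∃ (V' : Scheme.{0}) (π : V' ⟶ V) (_ : IsIntegral V') (_ : IsDominant π) (K' : V'.IdealSheafData),
        IsCleanPermissibleSeq p π (J.comap V.ι) m K' (RatFn.functionFieldMap V.ι G) ∧ ∀ y, idealOrder K' y < m) :
    ∀ (p : ℕ), p.Prime → ∀ (S : Scheme.{0}) [IsIntegral S] [IsNoetherian S],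
      CharP S.functionField p → Scheme.IsRegular S → Scheme.IsExcellent S → topologicalKrullDim S = 3 →
      ∀ G₀ : S.functionField, (∀ s : S, CleanRegAt p (algebraMap (S.presheaf.stalk s) S.functionField) G₀) →
      ∀ I : S.IdealSheafData, I ≠ ⊥ →
      ∀ (X : Scheme.{0}) (ρ : X ⟶ S) [IsIntegral X] [IsNoetherian X] [IsDominant ρ],
        IsCleanRegularCentreBlowupSeq p ρ I G₀ →
        (∀ x : X, CleanRegAt p (algebraMap (X.presheaf.stalk x) X.functionField) (RatFn.functionFieldMap ρ G₀)) →
        ∀ (J : X.IdealSheafData) (μ : ℕ), 1 ≤ μ →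
          (∀ x ∈ J.support, 1 < Order.coheight x) → (∀ x, idealOrder J x ≤ μ) → (∃ x, idealOrder J x = μ) →
          ∃ (X' : Scheme.{0}) (π : X' ⟶ X) (_ : IsIntegral X') (_ : IsDominant π) (J' : X'.IdealSheafData),
            IsCleanPermissibleSeq p π J μ J' (RatFn.functionFieldMap ρ G₀) ∧ ∀ x, idealOrder J' x < μ := by
  refine cleanProp44_of_tauOneResidualVN hphaseTwo htauOneVN ?_
  intro p hp X _ _ hchar hX hqe hX3 G hG J m hm hle hcodim V Y hYreg hirr hYV hJY hordY hcurve hτ _ _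
  by_cases H : (∀ y ∈ (Y : Set X), CleanPermissibleAt p (algebraMap (X.presheaf.stalk y) X.functionField) G (stalkIdeal (vanishingIdeal Y) y)) ∧
      (∀ (V₁ : Scheme.{0}) (π₁ : V₁ ⟶ (V : Scheme.{0})), IsBlowup π₁ (vanishingIdeal (Y.preimage V.ι.continuous)) →
        ∀ x' : V₁, IsClosed ({x'} : Set V₁) →
          π₁ x' ∈ ((Y.preimage V.ι.continuous : Closeds (V : Scheme.{0})) : Set (V : Scheme.{0})) →
          idealOrder (controlledTransform π₁ (vanishingIdeal (Y.preimage V.ι.continuous)) (J.comap V.ι) m) x' = m →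
          (maximalIdeal (V₁.presheaf.stalk x')).spanFinrank = 3 →
          ∀ hr : IsRegularLocalRing (V₁.presheaf.stalk x'),
            2 ≤ @stalkTau V₁ (controlledTransform π₁ (vanishingIdeal (Y.preimage V.ι.continuous)) (J.comap V.ι) m) x' hr m)
  · haveI := hchar
    exact exists_isCleanPermissibleSeq_lt_comap_of_curve_of_cleanPermissible_of_forall_near_two_le hp hX hqe hX3 G hG J hm hle hcodim V Y
      hYreg hirr hYV hJY hordY H.1 H.2
  · exact hcurveTauOneVN p hp hchar hX hqe hX3 G hG J hm hle hcodim V Y hYreg hirr hYV hJY hordY hcurve hτ H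

end Summit.ResolutionOfSingularities.ResolutionOfSingularities.Theorems.RadicialJung.CleanModels

end
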